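import Literature.AlgebraicGeometry.Resolution.ResolutionFibreDimension
import Literature.AlgebraicGeometry.Resolution.RationalSurfaceSingularitiesBasic
import Literature.AlgebraicGeometry.Resolution.MinimalResolutionUnique
import Literature.AlgebraicGeometry.Resolution.FiniteBirationalNormal
import HarnessLib

/-!
# Crux `NoZenoR` (stmt-ResolutionOfSingularities-19943) — RIGIDITY: morphisms over the base between birational models
# are unique (`hom_ext_of_isBirational`); the factorisation through a minimal desingularization is unique

Route `ResolutionOfSingularities/HomologicalConductor` (cell decomp-res, hand leafhand-res-homologicalconduct-18 g1).
OURS: AI-written proof over tree theorems, weaker than expert review; nothing here is a statement of the manuscript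
under review (Hironaka 2017).  SUPPORT level, counted 0.  Def-free, no new named facts.

The tree's `MinimalResolutionUnique.lean` proves the endomorphism case `IsResolution.eq_id_of_comp_eq` and remarks that
two `B`-morphisms INTO a resolution «need not agree» in general.  They DO agree as soon as the source is itself
birational over the base:

* `isDominant_fromSpecStalk_genericPoint` — `Spec K(Z) → Z` is dominant;
* **`hom_ext_of_isBirational`** — `Z`, `X`, `B` integral, `f : X → B` separated and birational, `k₁, k₂ : Z → X` with
  `k₁ ≫ f = k₂ ≫ f` birational ⇒ `k₁ = k₂`.  Proof: both `kᵢ` send the generic point `ξ` of `Z` to the generic point of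
  `X` (`IsBirational.eq_genericPoint_of_apply_eq`), so `Spec K(Z) → Z → X` is `Spec` of a field map
  `ψᵢ : K(X) → K(Z)` followed by `Spec K(X) → X`; after `f` the two composites agree, `Spec K(B) → B` is a monomorphism
  and `K(B) → K(X)` is an isomorphism, so `ψ₁ = ψ₂`; two morphisms from the reduced `Z` to the `B`-separated `X` that
  agree on the dominant `Spec K(Z) → Z` are equal (Mathlib `ext_of_isDominant_of_isSeparated`);
* `hom_ext_of_isResolution` — the case of two desingularizations of an integral base;
* `isMinimalResolution_fac_unique` — the factorisation `Z → X` of a desingularization through a minimal one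
  (`IsMinimalResolution`, Bădescu's «factors (uniquely)») is unique.

No crux or summit statement is proved here.
-/

noncomputable section

-- single-problem summit: the doubled namespace component `ResolutionOfSingularities` is forced
set_option linter.dupNamespace false

open CategoryTheory AlgebraicGeometry TopologicalSpace Topology IsLocalRing
open Literature.AlgebraicGeometry.Resolution Literature.AlgebraicGeometry.Motives

universe u

namespace Summit.ResolutionOfSingularities.ResolutionOfSingularities.Theorems.NoZeno.FirstKind

/-- `Spec K(Z) → Z` (the canonical morphism from the spectrum of the stalk at the generic point) is dominant: its
image is the generic point. [folklore] -/
theorem isDominant_fromSpecStalk_genericPoint (Z : Scheme.{u}) [IsIntegral Z] :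
    IsDominant (Z.fromSpecStalk (genericPoint Z)) := by
  refine ⟨?_⟩
  rw [DenseRange, Scheme.range_fromSpecStalk]
  have hsub : ({genericPoint Z} : Set Z) ⊆ {y | y ⤳ genericPoint Z} := by
    rintro _ rfl; exact specializes_rfl
  exact Dense.mono hsub (dense_iff_closure_eq.mpr (genericPoint_spec Z))

/-- **Morphisms over the base between birational models are unique.**  Let `Z`, `X`, `B` be integral, `f : X → B`
separated and birational, and `k₁, k₂ : Z → X` with `k₁ ≫ f = k₂ ≫ f` birational.  Then `k₁ = k₂`.
[cite: Badescu2001, Prop. 4.5 ("factors uniquely")]; [cite: StacksProject, Tag 01RN] -/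
theorem hom_ext_of_isBirational {Z X B : Scheme.{u}} [IsIntegral Z] [IsIntegral X] [IsIntegral B]
    (f : X ⟶ B) [IsSeparated f] (hf : IsBirational f) {k₁ k₂ : Z ⟶ X}
    (hg : IsBirational (k₁ ≫ f)) (e : k₁ ≫ f = k₂ ≫ f) : k₁ = k₂ := by
  set ξ := genericPoint Z with hξ
  haveI : IsDominant (k₁ ≫ f) := hg.isDominant
  haveI : IsDominant f := hf.isDominant
  -- both `kᵢ` send the generic point to the generic point
  have hgen : ∀ {k : Z ⟶ X}, k ≫ f = k₁ ≫ f → k.base ξ = genericPoint X := fun {k} hk => by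
    apply hf.eq_genericPoint_of_apply_eq
    change (k ≫ f).base ξ = genericPoint B
    rw [hk]
    exact RatFn.genericPoint_eq_of_isDominant (k₁ ≫ f)
  have h1 : k₁.base ξ = genericPoint X := hgen rfl
  have h2 : k₂.base ξ = genericPoint X := hgen e.symm
  -- `Spec K(Z) → Z → X` as `Spec (ψᵢ) ≫ (Spec K(X) → X)`
  set ι := Z.fromSpecStalk ξ with hι
  let ψ : ∀ (k : Z ⟶ X), k.base ξ = genericPoint X →
      (X.presheaf.stalk (genericPoint X) ⟶ Z.presheaf.stalk ξ) := fun k hk =>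
    X.presheaf.stalkSpecializes (specializes_of_eq hk) ≫ k.stalkMap ξ
  have key : ∀ (k : Z ⟶ X) (hk : k.base ξ = genericPoint X),
      ι ≫ k = Spec.map (ψ k hk) ≫ X.fromSpecStalk (genericPoint X) := by
    intro k hk
    change ι ≫ k = Spec.map (X.presheaf.stalkSpecializes (specializes_of_eq hk) ≫ k.stalkMap ξ) ≫ _
    rw [Spec.map_comp, Category.assoc, Scheme.SpecMap_stalkSpecializes_fromSpecStalk,
      Scheme.SpecMap_stalkMap_fromSpecStalk]
  have keyf : ∀ (k : Z ⟶ X) (hk : k.base ξ = genericPoint X),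
      ι ≫ k ≫ f = Spec.map (f.stalkMap (genericPoint X) ≫ ψ k hk) ≫ B.fromSpecStalk (f.base (genericPoint X)) := by
    intro k hk
    rw [← Category.assoc, key k hk, Category.assoc, ← Scheme.SpecMap_stalkMap_fromSpecStalk, ← Category.assoc,
      ← Spec.map_comp]
  -- after `f` the two composites agree; cancel the monomorphism `Spec K(B) → B` and the isomorphism `K(B) ≅ K(X)`
  have hψ : ψ k₁ h1 = ψ k₂ h2 := by
    have hcomp : ι ≫ k₁ ≫ f = ι ≫ k₂ ≫ f := by rw [e]
    rw [keyf k₁ h1, keyf k₂ h2, cancel_mono, Spec.map_inj] at hcomp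
    haveI : IsIso (f.stalkMap (genericPoint X)) := hf.isIso_stalkMap_genericPoint
    exact (cancel_epi (f.stalkMap (genericPoint X))).mp hcomp
  have hι12 : ι ≫ k₁ = ι ≫ k₂ := by rw [key k₁ h1, key k₂ h2, hψ]
  haveI : IsDominant ι := isDominant_fromSpecStalk_genericPoint Z
  exact ext_of_isDominant_of_isSeparated f e ι hι12

/-- **Two `B`-morphisms between desingularizations of an integral base coincide.** [cite: Badescu2001, Prop. 4.5] -/
theorem hom_ext_of_isResolution {Z X B : Scheme.{u}} [IsIntegral B] {f : X ⟶ B} {g : Z ⟶ B}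
    (hf : IsResolution f) (hg : IsResolution g) {k₁ k₂ : Z ⟶ X} (h₁ : k₁ ≫ f = g) (h₂ : k₂ ≫ f = g) :
    k₁ = k₂ := by
  haveI : IsIntegral X := hf.isIntegral_source
  haveI : IsIntegral Z := hg.isIntegral_source
  haveI : IsProper f := hf.isProper
  refine hom_ext_of_isBirational f hf.isBirational ?_ (h₁.trans h₂.symm)
  rw [h₁]; exact hg.isBirational

/-- **The factorisation through a minimal desingularization is unique** (Bădescu: "every desingularization factors
UNIQUELY through the minimal one"): for `f : X → B` with the universal property `IsMinimalResolution` over an integral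
`B` and a desingularization `g : Z → B`, there is exactly one `k : Z → X` with `k ≫ f = g`. [cite: Badescu2001, Prop. 4.5] -/
theorem isMinimalResolution_fac_unique {Z X B : Scheme.{u}}
    [IsIntegral B] {f : X ⟶ B} (hf : IsMinimalResolution f) {g : Z ⟶ B} (hg : IsResolution g) :
    ∃! k : Z ⟶ X, k ≫ f = g := by
  obtain ⟨k, hk⟩ := hf.2 Z g hg
  exact ⟨k, hk, fun k' hk' => hom_ext_of_isResolution hf.1 hg hk' hk⟩

end Summit.ResolutionOfSingularities.ResolutionOfSingularities.Theorems.NoZeno.FirstKind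

end
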